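import Summits.BirchSwinnertonDyer.BirchSwinnertonDyer.Theorems.BiquadraticEisensteinDescentSymbolicMonskyPatternFreeDefs
import Summits.BirchSwinnertonDyer.BirchSwinnertonDyer.Theorems.BiquadraticEisensteinDescentHeegnerTwistCouplingInSupplySymbolicMonskySound
import HarnessLib

set_option linter.dupNamespace false -- `Summit.BirchSwinnertonDyer.BirchSwinnertonDyer.Theorems.…` (summit = sub)
set_option autoImplicit false

/-!
# Crux `HeegnerTwistCouplingInSupply` (stmt-BirchSwinnertonDyer-21381) — PATTERN-FREE CRITERION, part 1 (abstract):
# two `𝔽₂`-matrices agreeing off an auxiliary block, and soundness of the verified difference check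

Route `BiquadraticEisensteinDescent` (cell `pub/bsd-wall`, width seat `bsd-wall-cm-bed-w3` g20; `--supports` 21381, helper). Companion
proof file (1/3) of the reviewed definitions `…SymbolicMonskyPatternFreeDefs`.

THE QUESTION (w3 g19, LINNIK-CENSUS-KERNEL §5–§6). A sign-table recipe fixes the cells of the auxiliary primes `q₁ … q_t` but not their
MUTUAL symbols `(q_j/q_i)`; it is PATTERN-FREE when Monsky's matrix is invertible for every mutual pattern — then its supply is `t`
independent located-prime conditions and the Linnik census applies. So far certified per family by `decide` over all `2^(t(t−1)/2)`
patterns (`k = 1`) or by a solver (`k = 2, 3`). THE MECHANISM: the mutual symbols change neither the rows outside the auxiliary block `Q`,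
nor the action on `Q`-constant vectors, nor the `Q`-row SUMS; hence (§2, `det_eq_one_of_agree_off_block`) if `det M = 1` and every
vector killed by the rows outside `Q` and by the two `Q`-row sums is `Q`-constant, every matrix agreeing with `M` in this sense is
invertible (kernel argument, `Matrix.exists_mulVec_eq_zero_iff`). The spanning hypothesis is what the computable `diffCheckRows`
certifies (§2, `qconst_of_diffCheckRows`): an admissible selector whose rows XOR to `2^a ⊕ 2^b` is a functional vanishing under the
hypotheses and equal to `z_a + z_b` (`selector_identity` through `matOfRows` / `finSumFinEquiv`). Part 2 (`…PatternFreeSymb`) supplies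
(i)–(iii) for `SymbData.AgreeOffAux` and the ★ criterion theorems; part 3 (`…PatternFreeDoor`) the general-`k` doors.

HONEST FRAMING: linear algebra over `𝔽₂`; proves no instance by itself; the crux as stated (C⁺), its registered stubs and BSD are NOT
touched; nothing is closed. THEOREMS ONLY (no `def`). References: [HeathBrown1994] appendix (Monsky), typescript pp. 39–41;
[Feng1996] K. Feng, Acta Arith. 75 (1996) §2 (rank of `M(G)` over `𝔽₂`).
-/

namespace Summit.BirchSwinnertonDyer.BirchSwinnertonDyer.Theorems.SymbolicMonsky

/-! ## §1 `𝔽₂` bookkeeping -/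

section FTwo

/-- `bz` is additive for XOR (public copy; the lemma of this statement in `…SymbolicMonskySound` is private). -/
theorem bz_xor_add (a b : Bool) : bz (xor a b) = bz a + bz b := by
  cases a <;> cases b <;> decide

/-- Every element of `𝔽₂` is `0` or `1`. -/
theorem zmod_two_eq_zero_or_eq_one (a : ZMod 2) : a = 0 ∨ a = 1 := by
  fin_cases a
  · exact Or.inl rfl
  · exact Or.inr rfl

/-- `a + a = 0` in `𝔽₂`. -/
theorem zmod_two_add_self (a : ZMod 2) : a + a = 0 := by
  fin_cases a <;> decide

/-- `a = b` in `𝔽₂` iff `a + b = 0`. -/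
theorem zmod_two_eq_iff_add_eq_zero (a b : ZMod 2) : a = b ↔ a + b = 0 := by
  constructor
  · rintro rfl; exact zmod_two_add_self a
  · intro h
    calc a = -b := eq_neg_of_add_eq_zero_left h
      _ = b := ZMod.neg_eq_self_mod_two b

/-- `bz b = 0 ↔ b = false`. -/
theorem bz_eq_zero_iff (b : Bool) : bz b = 0 ↔ b = false := by
  cases b <;> decide

end FTwo

/-! ## §2 The abstract criterion: two matrices that agree off an auxiliary block -/

section Abstract

open Matrix

variable {k : ℕ}

/-- **Abstract pattern-free criterion.** Let `M, M'` be `𝔽₂`-matrices on `Fin k ⊕ Fin k` and `Q` an auxiliary block such that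
(i) the rows of `M'` and `M` outside `Q` agree, (ii) `M' z = M z` for every `z` constant on `Q` in each half, (iii) the `Q`-row sums
of `M' z` and `M z` agree in each half. If `det M = 1` and every `z` killed by the rows of `M` outside `Q` and by the two `Q`-row
sums of `M` is constant on `Q` in each half, then `det M' = 1`. [folklore] -/
theorem det_eq_one_of_agree_off_block (Q : Fin k → Bool) (M M' : Matrix (Fin k ⊕ Fin k) (Fin k ⊕ Fin k) (ZMod 2))
    (hout : ∀ z i, Q i = false →
      (M' *ᵥ z) (Sum.inl i) = (M *ᵥ z) (Sum.inl i) ∧ (M' *ᵥ z) (Sum.inr i) = (M *ᵥ z) (Sum.inr i))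
    (hconst : ∀ z, (∀ i j, Q i = true → Q j = true → z (Sum.inl i) = z (Sum.inl j) ∧ z (Sum.inr i) = z (Sum.inr j)) →
      M' *ᵥ z = M *ᵥ z)
    (hsum : ∀ z, (∑ i ∈ Finset.univ.filter (fun i => Q i = true), (M' *ᵥ z) (Sum.inl i)) =
        (∑ i ∈ Finset.univ.filter (fun i => Q i = true), (M *ᵥ z) (Sum.inl i)) ∧
      (∑ i ∈ Finset.univ.filter (fun i => Q i = true), (M' *ᵥ z) (Sum.inr i)) =
        (∑ i ∈ Finset.univ.filter (fun i => Q i = true), (M *ᵥ z) (Sum.inr i)))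
    (hdet : M.det = 1)
    (hspan : ∀ z : Fin k ⊕ Fin k → ZMod 2,
      (∀ i, Q i = false → (M *ᵥ z) (Sum.inl i) = 0 ∧ (M *ᵥ z) (Sum.inr i) = 0) →
      (∑ i ∈ Finset.univ.filter (fun i => Q i = true), (M *ᵥ z) (Sum.inl i)) = 0 →
      (∑ i ∈ Finset.univ.filter (fun i => Q i = true), (M *ᵥ z) (Sum.inr i)) = 0 →
      ∀ i j, Q i = true → Q j = true → z (Sum.inl i) = z (Sum.inl j) ∧ z (Sum.inr i) = z (Sum.inr j)) :
    M'.det = 1 := by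
  classical
  have key : ∀ z, M' *ᵥ z = 0 → z = 0 := by
    intro z hz
    have h1 : ∀ i, Q i = false → (M *ᵥ z) (Sum.inl i) = 0 ∧ (M *ᵥ z) (Sum.inr i) = 0 := by
      intro i hi
      obtain ⟨ha, hb⟩ := hout z i hi
      exact ⟨by rw [← ha, hz]; rfl, by rw [← hb, hz]; rfl⟩
    obtain ⟨hs1, hs2⟩ := hsum z
    have h2 : (∑ i ∈ Finset.univ.filter (fun i => Q i = true), (M *ᵥ z) (Sum.inl i)) = 0 := by
      rw [← hs1]; exact Finset.sum_eq_zero fun i _ => by rw [hz]; rfl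
    have h3 : (∑ i ∈ Finset.univ.filter (fun i => Q i = true), (M *ᵥ z) (Sum.inr i)) = 0 := by
      rw [← hs2]; exact Finset.sum_eq_zero fun i _ => by rw [hz]; rfl
    have hc := hspan z h1 h2 h3
    have hMz : M *ᵥ z = 0 := by rw [← hconst z hc, hz]
    by_contra hne
    have : M.det = 0 := Matrix.exists_mulVec_eq_zero_iff.mp ⟨z, hne, hMz⟩
    rw [hdet] at this
    exact one_ne_zero this
  rcases zmod_two_eq_zero_or_eq_one M'.det with h0 | h1
  · obtain ⟨v, hv, hMv⟩ := Matrix.exists_mulVec_eq_zero_iff.mpr h0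
    exact absurd (key v hMv) hv
  · exact h1

/-! ### The verified difference check is sound (abstract in the matrix) -/

/-- Row `c · M̂` of a selector against bitmask rows: `∑_l ĉ_l M̂_{l j} = bit j of the selected XOR`. -/
theorem sum_bz_testBit_mul_matOfRows (R : List ℕ) (hR : R.length = k + k) (c : ℕ) (j : Fin (k + k)) :
    (∑ l : Fin (k + k), bz (c.testBit l.val) * matOfRows (k + k) R l j) = bz ((xorSelFrom c 0 R).testBit j.val) := by
  simp only [matOfRows, Matrix.of_apply, bz_and_mul]
  rw [sum_fin_bz (k + k) (fun l => c.testBit l && (R.getD l 0).testBit j), testBit_xorSelFrom, hR]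
  simp only [Nat.zero_add]

/-- The functional of a selector `c` on `M z` equals the functional of the selected XOR `δ` on `z` (through the reindexing
`Fin (k + k) ≃ Fin k ⊕ Fin k`). -/
theorem selector_identity (M : Matrix (Fin k ⊕ Fin k) (Fin k ⊕ Fin k) (ZMod 2)) (R : List ℕ) (hR : R.length = k + k)
    (hM : matOfRows (k + k) R = Matrix.reindex finSumFinEquiv finSumFinEquiv M) (c δ : ℕ)
    (hsel : xorSelFrom c 0 R = δ) (z : Fin k ⊕ Fin k → ZMod 2) :
    (∑ l : Fin (k + k), bz (c.testBit l.val) * (M *ᵥ z) (finSumFinEquiv.symm l)) =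
      ∑ l : Fin (k + k), bz (δ.testBit l.val) * z (finSumFinEquiv.symm l) := by
  classical
  set e : Fin k ⊕ Fin k ≃ Fin (k + k) := finSumFinEquiv with he
  -- `M̂ ẑ = (M z) ∘ e.symm`
  have hmv : matOfRows (k + k) R *ᵥ (z ∘ e.symm) = (M *ᵥ z) ∘ e.symm := by
    rw [hM, Matrix.reindex_apply, Matrix.submatrix_mulVec_equiv]
    have hz : (z ∘ ⇑e.symm) ∘ ⇑e = z := by funext x; simp
    simp [hz]
  have lhs : (∑ l : Fin (k + k), bz (c.testBit l.val) * (M *ᵥ z) (e.symm l)) =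
      (fun l : Fin (k + k) => bz (c.testBit l.val)) ⬝ᵥ (matOfRows (k + k) R *ᵥ (z ∘ e.symm)) := by
    rw [hmv]; rfl
  rw [lhs, Matrix.dotProduct_mulVec]
  unfold dotProduct
  refine Finset.sum_congr rfl fun j _ => ?_
  congr 1
  rw [← hsel, ← sum_bz_testBit_mul_matOfRows R hR c j]
  rfl

/-- Splitting a selector functional over the two halves. -/
theorem sum_fin_add_bz (f : ℕ → Bool) (g : Fin k ⊕ Fin k → ZMod 2) :
    (∑ l : Fin (k + k), bz (f l.val) * g (finSumFinEquiv.symm l)) =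
      (∑ i : Fin k, bz (f i.val) * g (Sum.inl i)) + ∑ i : Fin k, bz (f (k + i.val)) * g (Sum.inr i) := by
  rw [Fin.sum_univ_add]
  congr 1
  · refine Finset.sum_congr rfl fun i _ => ?_
    rw [finSumFinEquiv_symm_apply_castAdd]; rfl
  · refine Finset.sum_congr rfl fun i _ => ?_
    rw [finSumFinEquiv_symm_apply_natAdd, Fin.val_natAdd]

/-- The functional of `δ = 2^a XOR 2^b` is `z_a + z_b`. -/
theorem sum_bz_testBit_two_pow_xor (a b : ℕ) (g : ℕ → ZMod 2) (n : ℕ) (ha : a < n) (hb : b < n) :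
    (∑ l : Fin n, bz ((2 ^ a ^^^ 2 ^ b).testBit l.val) * g l.val) = g a + g b := by
  have h1 : ∀ l : Fin n, bz ((2 ^ a ^^^ 2 ^ b).testBit l.val) * g l.val =
      (if l.val = a then g a else 0) + (if l.val = b then g b else 0) := by
    intro l
    rw [Nat.testBit_xor, Nat.testBit_two_pow, Nat.testBit_two_pow, bz_xor_add, add_mul]
    congr 1
    · by_cases h : a = l.val
      · subst h; simp [bz]
      · have : ¬ l.val = a := fun h' => h h'.symm
        simp [h, this, bz]
    · by_cases h : b = l.val
      · subst h; simp [bz]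
      · have : ¬ l.val = b := fun h' => h h'.symm
        simp [h, this, bz]
  rw [Finset.sum_congr rfl fun l _ => h1 l, Finset.sum_add_distrib]
  have single : ∀ (x : ℕ) (hx : x < n), (∑ l : Fin n, if l.val = x then g x else 0) = g x := by
    intro x hx
    rw [Finset.sum_eq_single (⟨x, hx⟩ : Fin n)]
    · simp
    · intro l _ hl
      have : l.val ≠ x := fun h => hl (Fin.ext h)
      simp [this]
    · intro h; exact absurd (Finset.mem_univ _) h
  rw [single a ha, single b hb]

/-- Unpacking `admissibleSel`. -/
theorem admissibleSel_spec {Q : Fin k → Bool} {c : ℕ} (h : admissibleSel k Q c = true) {i j : Fin k}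
    (hi : Q i = true) (hj : Q j = true) :
    c.testBit i.val = c.testBit j.val ∧ c.testBit (k + i.val) = c.testBit (k + j.val) := by
  simp only [admissibleSel, List.all_eq_true, List.mem_finRange, true_implies, Bool.or_eq_true, Bool.not_eq_true',
    Bool.and_eq_false_iff, Bool.and_eq_true, beq_iff_eq] at h
  rcases h i j with h | h
  · rcases h with h | h
    · rw [hi] at h; exact absurd h (by decide)
    · rw [hj] at h; exact absurd h (by decide)
  · exact h

/-- **One verified difference check is sound**: under the hypotheses "rows outside `Q` kill `z`" and "the `Q`-row sums kill `z`",
an admissible selector whose rows XOR to `2^a XOR 2^b` forces `ẑ_a = ẑ_b` (coordinates through `finSumFinEquiv`). -/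
theorem eq_of_diffCheckOne (Q : Fin k → Bool) (M : Matrix (Fin k ⊕ Fin k) (Fin k ⊕ Fin k) (ZMod 2)) (R : List ℕ)
    (hR : R.length = k + k) (hM : matOfRows (k + k) R = Matrix.reindex finSumFinEquiv finSumFinEquiv M)
    {a b : ℕ} (ha : a < k + k) (hb : b < k + k) (h : diffCheckOne k Q R (2 ^ a ^^^ 2 ^ b) = true)
    (z : Fin k ⊕ Fin k → ZMod 2)
    (hz : ∀ i, Q i = false → (M *ᵥ z) (Sum.inl i) = 0 ∧ (M *ᵥ z) (Sum.inr i) = 0)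
    (hs1 : (∑ i ∈ Finset.univ.filter (fun i => Q i = true), (M *ᵥ z) (Sum.inl i)) = 0)
    (hs2 : (∑ i ∈ Finset.univ.filter (fun i => Q i = true), (M *ᵥ z) (Sum.inr i)) = 0) :
    z (finSumFinEquiv.symm ⟨a, ha⟩) = z (finSumFinEquiv.symm ⟨b, hb⟩) := by
  classical
  simp only [diffCheckOne, Bool.and_eq_true, beq_iff_eq] at h
  obtain ⟨hadm, hsel⟩ := h
  set c := solveSel (pfGens k Q R) (2 ^ a ^^^ 2 ^ b) with hc
  have hid := selector_identity M R hR hM c _ hsel z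
  -- the left-hand side vanishes
  have hL : (∑ l : Fin (k + k), bz (c.testBit l.val) * (M *ᵥ z) (finSumFinEquiv.symm l)) = 0 := by
    rw [sum_fin_add_bz (fun n => c.testBit n) (M *ᵥ z)]
    -- pick a reference element of `Q` if any; each half-sum is (constant) * (Q-row sum) + 0
    have half : ∀ (f : Fin k → Bool) (g : Fin k → ZMod 2), (∀ i j, Q i = true → Q j = true → f i = f j) →
        (∀ i, Q i = false → g i = 0) → (∑ i ∈ Finset.univ.filter (fun i => Q i = true), g i) = 0 →
        (∑ i : Fin k, bz (f i) * g i) = 0 := by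
      intro f g hf hg hs
      by_cases hQ : ∃ i₀, Q i₀ = true
      · obtain ⟨i₀, hi₀⟩ := hQ
        have : ∀ i, bz (f i) * g i = bz (f i₀) * (if Q i = true then g i else 0) := by
          intro i
          by_cases hqi : Q i = true
          · rw [hf i i₀ hqi hi₀]; simp [hqi]
          · simp [hqi, hg i (by simpa using hqi)]
        rw [Finset.sum_congr rfl fun i _ => this i, ← Finset.mul_sum, ← Finset.sum_filter, hs, mul_zero]
      · push Not at hQ
        exact Finset.sum_eq_zero fun i _ => by rw [hg i (by simpa using hQ i), mul_zero]
    rw [half (fun i => c.testBit i.val) (fun i => (M *ᵥ z) (Sum.inl i))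
        (fun i j hi hj => (admissibleSel_spec hadm hi hj).1) (fun i hi => (hz i hi).1) hs1,
      half (fun i => c.testBit (k + i.val)) (fun i => (M *ᵥ z) (Sum.inr i))
        (fun i j hi hj => (admissibleSel_spec hadm hi hj).2) (fun i hi => (hz i hi).2) hs2, add_zero]
  rw [hL] at hid
  have hR' := sum_bz_testBit_two_pow_xor a b (fun n => if hn : n < k + k then z (finSumFinEquiv.symm ⟨n, hn⟩) else 0)
    (k + k) ha hb
  have hre : (∑ l : Fin (k + k), bz ((2 ^ a ^^^ 2 ^ b).testBit l.val) *
      (fun n => if hn : n < k + k then z (finSumFinEquiv.symm ⟨n, hn⟩) else 0) l.val) =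
      ∑ l : Fin (k + k), bz ((2 ^ a ^^^ 2 ^ b).testBit l.val) * z (finSumFinEquiv.symm l) :=
    Finset.sum_congr rfl fun l _ => by simp [l.isLt]
  rw [hre, ← hid] at hR'
  simp only [ha, hb, dite_true] at hR'
  exact (zmod_two_eq_iff_add_eq_zero _ _).mpr hR'.symm

/-- Unpacking the `match` of `diffCheckRows`: if some index lies in `Q`, there is a reference index `q₀ ∈ Q` such that every other
`q ∈ Q` passes both difference checks against `q₀`. -/
theorem diffCheckRows_spec {Q : Fin k → Bool} {R : List ℕ} (h : diffCheckRows k Q R = true) {q : Fin k} (hq : Q q = true) :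
    ∃ q₀ : Fin k, Q q₀ = true ∧ ∀ q' : Fin k, Q q' = true → q' ≠ q₀ →
      diffCheckOne k Q R (2 ^ q₀.val ^^^ 2 ^ q'.val) = true ∧
      diffCheckOne k Q R (2 ^ (k + q₀.val) ^^^ 2 ^ (k + q'.val)) = true := by
  unfold diffCheckRows at h
  have hmem : ∀ q' : Fin k, Q q' = true → q' ∈ (List.finRange k).filter Q := fun q' hq' =>
    List.mem_filter.mpr ⟨List.mem_finRange q', hq'⟩
  rcases hL : (List.finRange k).filter Q with _ | ⟨q₀, qs⟩
  · have := hmem q hq; rw [hL] at this; simp at this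
  · rw [hL] at h
    simp only [List.all_eq_true, Bool.and_eq_true] at h
    have hq₀ : Q q₀ = true := by
      have : q₀ ∈ (List.finRange k).filter Q := by rw [hL]; exact List.mem_cons_self
      exact (List.mem_filter.mp this).2
    refine ⟨q₀, hq₀, fun q' hq' hne => ?_⟩
    have : q' ∈ (List.finRange k).filter Q := hmem q' hq'
    rw [hL, List.mem_cons] at this
    rcases this with rfl | hqs
    · exact absurd rfl hne
    · exact h q' hqs

/-- **The verified difference check is sound**: every `z` killed by the rows of `M` outside `Q` and by the two `Q`-row sums of `M`
is constant on `Q` in each half. -/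
theorem qconst_of_diffCheckRows (Q : Fin k → Bool) (M : Matrix (Fin k ⊕ Fin k) (Fin k ⊕ Fin k) (ZMod 2)) (R : List ℕ)
    (hR : R.length = k + k) (hM : matOfRows (k + k) R = Matrix.reindex finSumFinEquiv finSumFinEquiv M)
    (h : diffCheckRows k Q R = true) (z : Fin k ⊕ Fin k → ZMod 2)
    (hz : ∀ i, Q i = false → (M *ᵥ z) (Sum.inl i) = 0 ∧ (M *ᵥ z) (Sum.inr i) = 0)
    (hs1 : (∑ i ∈ Finset.univ.filter (fun i => Q i = true), (M *ᵥ z) (Sum.inl i)) = 0)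
    (hs2 : (∑ i ∈ Finset.univ.filter (fun i => Q i = true), (M *ᵥ z) (Sum.inr i)) = 0)
    (i j : Fin k) (hi : Q i = true) (hj : Q j = true) :
    z (Sum.inl i) = z (Sum.inl j) ∧ z (Sum.inr i) = z (Sum.inr j) := by
  obtain ⟨q₀, hq₀, hall⟩ := diffCheckRows_spec h hi
  -- every `q ∈ Q` agrees with `q₀` in both halves
  have one : ∀ q : Fin k, Q q = true → z (Sum.inl q) = z (Sum.inl q₀) ∧ z (Sum.inr q) = z (Sum.inr q₀) := by
    intro q hq
    by_cases hne : q = q₀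
    · subst hne; exact ⟨rfl, rfl⟩
    obtain ⟨h1, h2⟩ := hall q hq hne
    have e1 := eq_of_diffCheckOne Q M R hR hM (a := q₀.val) (b := q.val) (by omega) (by omega) h1 z hz hs1 hs2
    have e2 := eq_of_diffCheckOne Q M R hR hM (a := k + q₀.val) (b := k + q.val) (by omega) (by omega) h2 z hz hs1 hs2
    have c1 : finSumFinEquiv.symm (⟨q₀.val, by omega⟩ : Fin (k + k)) = Sum.inl q₀ :=
      finSumFinEquiv_symm_apply_castAdd (n := k) q₀
    have c2 : finSumFinEquiv.symm (⟨q.val, by omega⟩ : Fin (k + k)) = Sum.inl q :=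
      finSumFinEquiv_symm_apply_castAdd (n := k) q
    have c3 : finSumFinEquiv.symm (⟨k + q₀.val, by omega⟩ : Fin (k + k)) = Sum.inr q₀ :=
      finSumFinEquiv_symm_apply_natAdd (m := k) q₀
    have c4 : finSumFinEquiv.symm (⟨k + q.val, by omega⟩ : Fin (k + k)) = Sum.inr q :=
      finSumFinEquiv_symm_apply_natAdd (m := k) q
    rw [c1, c2] at e1
    rw [c3, c4] at e2
    exact ⟨e1.symm, e2.symm⟩
  obtain ⟨a1, a2⟩ := one i hi
  obtain ⟨b1, b2⟩ := one j hj
  exact ⟨a1.trans b1.symm, a2.trans b2.symm⟩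

end Abstract

end Summit.BirchSwinnertonDyer.BirchSwinnertonDyer.Theorems.SymbolicMonsky
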